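import Literature.Barriers.AnomalousDissipation.ShearFlowViscositySelectionSzekelyhidi
import Literature.Barriers.AnomalousDissipation.VortexSheetWild
import HarnessLib

/-!
# Barrier (Onsager programme / anomalous dissipation): Cor. 2 of Bardos–Titi–Wiedemann 2012
  reduced to Székelyhidi's localized convex-integration theorem (Thm. 1.3)

Barriers/AnomalousDissipation file joining the two accepted reductions of the barrier statement
`BardosTitiWiedemann2012_cor2` (`ShearFlowViscositySelection`; Bardos–Titi–Wiedemann, C. R.
Math. 350 (2012), Cor. 2: infinitely many admissible weak Euler solutions on `T³ × [0,T]` with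
the vortex-sheet shear datum `(v₁(x₂), 0, v₃(x₁,x₂))`, `v₃ ∈ L²(T²)` arbitrary):

* `BardosTitiWiedemann2012_cor2_of_szekelyhidi : Szekelyhidi2011_thm11 → BardosTitiWiedemann2012_cor2`
  (`ShearFlowViscositySelectionSzekelyhidi`: the printed proof of Cor. 2 — the 2½-dimensional
  lift of Székelyhidi's wild vortex-sheet solutions along a passively transported third
  component, with the transport equation solved by the proved Fourier–Galerkin theorem
  `Torus.transportExistence_of_weaklyContinuous`), and
* `Szekelyhidi2011_thm11_of_thm13 : Torus.Szekelyhidi2011_thm13 → Szekelyhidi2011_thm11`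
  (`VortexSheetWild`: Székelyhidi 2011, Thm. 1.1 from his Thm. 1.3 via the explicit
  vortex-sheet subsolution of §2, `VortexSheetSubsolution*`).

Hence

* `BardosTitiWiedemann2012_cor2_of_thm13 : Torus.Szekelyhidi2011_thm13 → BardosTitiWiedemann2012_cor2`:

the corollary rests on the single named fact
`Literature.Analysis.FluidPDE.Torus.Szekelyhidi2011_thm13` (`EulerSubsolutionCriterion`;
Székelyhidi 2011, Thm. 1.3 = De Lellis–Székelyhidi 2010, Prop. 2, localized: two-dimensional
convex integration), whose constructive proof is being built in
`Literature/Analysis/FluidPDE/ConvexIntegration2D*.lean`. The discharge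
`BardosTitiWiedemann2012_cor2_holds` is then the one-line application of this theorem to
`Szekelyhidi2011_thm13_holds`. Everything here is proved; no definitions, no new named facts.

## References

* C. Bardos, E. S. Titi, E. Wiedemann, C. R. Math. Acad. Sci. Paris 350 (2012) 757–760, Thm. 1,
  Cor. 2 and its proof (`BardosTitiWiedemann2012`).
* L. Székelyhidi Jr., C. R. Math. Acad. Sci. Paris 349 (2011) 1063–1066, Thm. 1.1, Thm. 1.3, §2
  (`Szekelyhidi2011`).
* C. De Lellis, L. Székelyhidi Jr., Arch. Ration. Mech. Anal. 195 (2010) 225–260, Prop. 2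
  (`DeLellisSzekelyhidi2010`).
-/

namespace Literature.Barriers.AnomalousDissipation

/-- **Bardos–Titi–Wiedemann 2012, Cor. 2, from Székelyhidi's localized convex-integration
theorem** (Székelyhidi 2011, Thm. 1.3, two-dimensional every-time-slice form
`Torus.Szekelyhidi2011_thm13`): composition of the printed proof of Cor. 2
(`BardosTitiWiedemann2012_cor2_of_szekelyhidi`, from Thm. 1 = Székelyhidi 2011, Thm. 1.1) with
the printed proof of Székelyhidi's Thm. 1.1 from his Thm. 1.3 (`Szekelyhidi2011_thm11_of_thm13`).
[cite: BardosTitiWiedemann2012, Cor. 2 and its proof] [cite: Szekelyhidi2011, Thm. 1.1, Thm. 1.3, §2] -/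
theorem BardosTitiWiedemann2012_cor2_of_thm13
    (h13 : Literature.Analysis.FluidPDE.Torus.Szekelyhidi2011_thm13) :
    BardosTitiWiedemann2012_cor2 :=
  BardosTitiWiedemann2012_cor2_of_szekelyhidi (Szekelyhidi2011_thm11_of_thm13 h13)

end Literature.Barriers.AnomalousDissipation
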